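import Summits.CriticalPhenomena.PercolationContinuityZ3.Theorems.PercNearOneGluingNoHeavyLowerTailSahiBlobCore
import Summits.CriticalPhenomena.PercolationContinuityZ3.Theorems.PercNearOneGluingNoHeavyLowerTailSahiPrincipalAntichainLeFive
import HarnessLib

/-!
# Two-terminal blob reduction, IV: small cores (computational companion)

Support file for the Sahi programme (`--supports stmt-CriticalPhenomena-4575`, prover prim-sahi-p2 gen 11).  COMPUTATIONAL: it
combines the standard-axiom core reduction `SahiBlobReduction.sahiE_principal_of_core` / `incStar_of_core` (Part III) with the
programme's kernel-computational small-graph theorems — `SahiPrincipalAntichain.sahiE_principal_fin_four` and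
`FrontierIncRows.incStar_le_five` (prim-bnk-1's `native_decide` comb certificates) — and therefore depends on those
`native_decide` axioms.  No definitions, no named facts, no sorries.  Memo `…/prim-sahi-p2/PROOF-E3.md` §22.

* `sahiE_principal_coreFour`: **`K₄` with its pairs replaced by arbitrary finite two-terminal networks** (arbitrary weights):
  every family of principal cluster events `{C_{c s} ⊇ c(T_i)}` with root and targets among the four branch vertices is
  Sahi-positive at EVERY order.
* `incStar_coreLeFive`: **a core of at most five vertices with arbitrary finite two-terminal networks between core pairs**:
  the increasing star `E₃({c s ↔ c a}, {c s ↔ c b}, {c s ↔ c d}) ≥ 0` for distinct core vertices `s, a, b, d`.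
-/

noncomputable section

namespace Summit.CriticalPhenomena.PercolationContinuityZ3.Theorems

namespace SahiBlobReduction

open Finset Set unitInterval MeasureTheory Literature.Probability.Percolation Literature.Probability.LatticeModels
  Literature.Combinatorics.Sahi2008
open Literature.Probability.Percolation.DecisionTree (ind ind_of_mem ind_of_not_mem ind_nonneg)
open scoped Classical

variable {V : Type*} [Fintype V]

/-- **`K₄` with blobs, every order.**  Let `c : Fin 4 → V` be injective and let every non-core vertex `x` carry a label
`β x = s(i,j)`, `i ≠ j`, such that the pairs of non-zero weight at `x` go to non-core vertices with the same label or to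
`c i, c j`.  Then for every root `c s` and every family of core target sets, `E_n ≥ 0`. [this work] -/
theorem sahiE_principal_coreFour (w : Sym2 V → unitInterval) {c : Fin 4 → V} (hc : Function.Injective c)
    (β : V → Sym2 (Fin 4)) (hβ : ∀ x, x ∉ Set.range c → ¬ (β x).IsDiag)
    (hw : ∀ x, x ∉ Set.range c → ∀ z, w s(x, z) ≠ 0 →
      (z ∉ Set.range c ∧ β z = β x) ∨ (∃ i ∈ β x, z = c i))
    (s : Fin 4) (n : ℕ) (T : Fin n → Finset (Fin 4)) :
    0 ≤ sahiE (bernoulliWeight w) n (fun k => ind (⋂ t ∈ T k, (openConn (c s) (c t) : Set (BondConfig V)))) :=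
  sahiE_principal_of_core w hc β hβ hw s (fun w₀ n T => SahiPrincipalAntichain.sahiE_principal_fin_four w₀ s n T) n T

/-- **Cores with at most five vertices, with blobs: the increasing star.**  For an injective core `c : Fin m → V`, `m ≤ 5`,
labelled blobs as above, and distinct core indices `s, a, b, d`:
`0 ≤ E₃({c s ↔ c a}, {c s ↔ c b}, {c s ↔ c d})`. [this work] -/
theorem incStar_coreLeFive {m : ℕ} (hm : m ≤ 5) (w : Sym2 V → unitInterval) {c : Fin m → V}
    (hc : Function.Injective c) (β : V → Sym2 (Fin m)) (hβ : ∀ x, x ∉ Set.range c → ¬ (β x).IsDiag)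
    (hw : ∀ x, x ∉ Set.range c → ∀ z, w s(x, z) ≠ 0 →
      (z ∉ Set.range c ∧ β z = β x) ∨ (∃ i ∈ β x, z = c i))
    (s a b d : Fin m) (hsa : s ≠ a) (hsb : s ≠ b) (hsd : s ≠ d) (hab : a ≠ b) (had : a ≠ d) (hbd : b ≠ d) :
    0 ≤ sahiE3 (prodBernoulli w) (openConn (c s) (c a)) (openConn (c s) (c b)) (openConn (c s) (c d)) :=
  incStar_of_core w hc β hβ hw s a b d fun w₀ => FrontierIncRows.incStar_le_five hm w₀ s a b d hsa hsb hsd hab had hbd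

end SahiBlobReduction

end Summit.CriticalPhenomena.PercolationContinuityZ3.Theorems
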